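import Summits.QuantumFields.BalabanUV.Beta.D1BFx.NeedleNdlShape
import Summits.QuantumFields.BalabanUV.Beta.D1BFx.RColumnProfileDipole
import Summits.QuantumFields.BalabanUV.Beta.D1BFx.ProjectorSupNorm

/-!
# `BalabanUV.Beta.D1BFx.NeedleDipShape` — road «BF-x» for binder row D1, slot (K), END row `hGrp gN`, «GN-DIP-SHAPE»: THE GHOST-KINETIC DIPOLE PIECE AS
# FOUR RANK-ONE TENSORS UNDER `dSw` — `dipPiece n a κ u = dSw (δρ_u ⊗ p_u + ρ_u ⊗ δp_u − p_u ⊗ δρ_u − δp_u ⊗ ρ_u)` (`ρ_u = RG(·,u)`, `δρ_u = RG(·,u+e_κ) − RG(·,u)`,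
# `p_u = Pgt(u,·)`, `δp_u = Pgt(u,·) − Pgt(u+e_κ,·)`), the localisation of the four factors, and the WORD SHAPE `dip ⊗ dSw(f ⊗ g)` as four explicit products of
# pairings — the structural input of the cells «KK», «KP»∕«PK», «KN»∕«NK» of the owner's claim table «GN-CELLS» (the mirror of the owner's `NeedleNdlShape`)

HONEST DEPENDENCY (cell records, verbatim): «continuum YM on T⁴ ⇐ BetaPertH ∧ nine spine estimates (0/9 proved); BetaPertH ⇐ (D1) ∧ (D4) ∧
CAP+tail; G-an2-4 gates asym, D1 and NE2/3/4.»  HONEST FRAMING (cell contract, verbatim): «discharging `BetaPertH` makes Bałaban's UV stability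
UNCONDITIONAL — a real constructive-QFT result; it is NOT the continuum limit and NOT the Clay problem.»  THIS MODULE DISCHARGES NOTHING of the
wall: [folklore] kernel algebra BY NAME over gan24-leaf-05's `GluonNeedleSplit.dipPiece_apply`, leaf-04-g6's `CornerVBlockRank.cornerV_ghCur_apply` (the
`V`-corner on the ghost current is the dipole `RG(x,u⁺)P(u,q) − RG(x,u)P(u⁺,q)`), the owner's «GN-𝔅» (`RankOneBubbleJets.dSw_tensor`, `bubble_dSw_dSw`,
`RankOneBubble.loc_outer`, `NeedleNdlShape.locV_of_blockDecay`) and the letters `RColumnProfile.abs_RG_le_profile`, `RColumnProfileDipole.abs_RG_right_diff_le_profile`,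
`ProjectorSupNorm.abs_Pgt_le_sup` ∕ `abs_Pgt_diff_le_sup` for the localisation.  No `def`, no `def … : Prop`, nothing cited, 0 sorry.  Asserts NO bound on any
cell.  Root-level binders hW ∕ hR-sockets ∕ hSX-socket ∕ D1Tel ∕ D1Rep — 0 discharged; (K) NOT closed; NOT D1, NOT `BetaPertH`, NOT continuum, NOT Clay.

ABSOLUTE RULE (cell charter, verbatim): «No internally-minted statement may enter as a cited fact. Every hypothesis is either kernel-proved in
this package or a verbatim quotation of a PUBLISHED theorem with page reference. The manuscript(s) under audit are NOT citable for their own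
disputed steps — they are the thing under adjudication; programme-internal (2001/route/tribunal) claims are never citable.»

WHY (owner RULING ρ-g10-5 (a) «GN-33∕KK → leaf-04-g9», an3-g59 §3′ (4) R2⊗R2; leaf-04-g9 STATEMENT-FIRST journal 2026-08-21T11:16Z): with this identity and
`bubble_dSw_dSw` the `dip ⊗ dip` word is `Σ_{i,j≤4} ±⟨∇g_i, Ga∇f′_j⟩·⟨Ga∇f_i, ∇g′_j⟩`, `(f,g)_i ∈ {(δρ,p),(ρ,δp),(p,δρ),(δp,ρ)}`, and every cell with one
dipole slot is four products of a pairing letter and a partner letter.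

CONTENT (`a > 0`, `n ≥ 1`; the four functions are written inline as lambdas, no definition).
* §1 [folklore] **`dipPiece_eq_dSw_tensor`**, **`dipPiece_eq_outer`**.
* §2 [folklore] `locV_of_siteDamped` (a scale-`n` site damping ⇒ `LocV`, via `l1 ≤ 4‖·‖∞`), `locV_rho`, `locV_drho`, `locV_p`, `locV_dp`, `loc_dipPiece'`.
* §3 [folklore] **`bubble_dip_dSw`** (`dip ⊗ dSw(f⊗g)` = four `bubble_dSw_dSw` products), **`bubble_dip_expand_right`** (`dip ⊗ (Σ± dSw tᵢ)` = Σ± of four bubbles — with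
  §3's first lemma the sixteen terms of «KK»).
NOT HERE (honest): any estimate.
Unit `b2b-balaban-beta-d1-formalise-leaf-04` (gen 9); `LEAVES-BFx.md` row (N) «GN-DIP-SHAPE».
-/

noncomputable section

namespace Summit.QuantumFields.BalabanUV.Beta.D1BFx.NeedleDipShape

open Finset
open scoped BigOperators
open Literature.MathematicalPhysics.QuantumFieldTheory.Balaban1983to89
open Literature.MathematicalPhysics.QuantumFieldTheory.Balaban1983to89.Beta
open B12Sec2to5 (l1 l1_nonneg)
open B6QGQLower276 (X e blk B mem_B)
open ExpKernelCalculus (Site MKer Decays bubble)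
open DyadicShell (Pt supNorm)
open AffineAveraging (unitVec)
open Summit.QuantumFields.BalabanUV.Beta.TameKernelCalculus (Spr Loc trK trK_apply bubble_add_left bubble_add_right)
open Summit.QuantumFields.BalabanUV.Beta.KernelWardRelative (bubble_sub_left)
open Summit.QuantumFields.BalabanUV.Beta.D1BFx.RProjector (Pgt deltaPP deltaPP_pos)
open Summit.QuantumFields.BalabanUV.Beta.D1BFx.ProjectorSupNorm (cPPs cPPs_nonneg abs_Pgt_le_sup abs_Pgt_diff_le_sup)
open Summit.QuantumFields.BalabanUV.Beta.D1BFx.GhostLeg (Ggh)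
open Summit.QuantumFields.BalabanUV.Beta.D1BFx.GhostStencil (ghCur)
open Summit.QuantumFields.BalabanUV.Beta.D1BFx.RProjectorJet (RG cornerV)
open Summit.QuantumFields.BalabanUV.Beta.D1BFx.RJetAssembly (dSw)
open Summit.QuantumFields.BalabanUV.Beta.D1BFx.CornerVBlockRank (cornerV_ghCur_apply)
open Summit.QuantumFields.BalabanUV.Beta.D1BFx.GluonNeedleSplit (dipPiece dipPiece_apply dSw_add dSw_sub)
open Summit.QuantumFields.BalabanUV.Beta.D1BFx.RColumnBlockMass (dR dR_pos)
open Summit.QuantumFields.BalabanUV.Beta.D1BFx.RColumnProfile (kV kP kV_nonneg_and abs_RG_le_profile)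
open Summit.QuantumFields.BalabanUV.Beta.D1BFx.RColumnProfileDipole (kD kD_nonneg abs_RG_right_diff_le_profile)
open Summit.QuantumFields.BalabanUV.Beta.D1BFx.GluonLegTails (l1_le_four_mul_supNorm)
open Summit.QuantumFields.BalabanUV.Beta.D1BFx.GhostLegFree (supNorm_eq)
open Summit.QuantumFields.BalabanUV.Beta.D1BFx.NeedleNdlShape (locV_of_blockDecay)
open Summit.QuantumFields.BalabanUV.Beta.D1BFx.RankOneBubble (outer applyK pairing LocV loc_outer bubble_sub_right)
open Summit.QuantumFields.BalabanUV.Beta.D1BFx.RankOneBubbleJets (grad tensor dSw_tensor locV_grad_of_locV loc_dSw_tensor bubble_dSw_dSw)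
open PoissonInterior (nrm nrm_pos one_le_nrm)

variable (n : ℕ) [NeZero n] (a : ℝ) (κ : Fin 4) (u : Site 4)

/-! ## §1 The dipole piece as four tensors under `dSw` -/

/-- [folklore] **«GN-DIP-SHAPE»**: `dipPiece n a κ u = dSw (tensor δρ_u p_u + tensor ρ_u δp_u − tensor p_u δρ_u − tensor δp_u ρ_u)` with `ρ_u x = RG(x,u)`,
`δρ_u x = RG(x,u+e_κ) − RG(x,u)`, `p_u q = Pgt(u,q)`, `δp_u q = Pgt(u,q) − Pgt(u+e_κ,q)` (from `cornerV_ghCur_apply`: the `V`-corner entry is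
`D(x,q) = RG(x,u⁺)P(u,q) − RG(x,u)P(u⁺,q) = δρ_u(x)p_u(q) + ρ_u(x)δp_u(q)`, and `dipPiece = dSw (D − Dᵀ)`). -/
theorem dipPiece_eq_dSw_tensor :
    dipPiece n a κ u =
      dSw (tensor (fun x => RG (Ggh n a) (Pgt n a) x (u + unitVec κ) () () - RG (Ggh n a) (Pgt n a) x u () ()) (fun q => Pgt n a u q () ())
        + tensor (fun x => RG (Ggh n a) (Pgt n a) x u () ()) (fun q => Pgt n a u q () () - Pgt n a (u + unitVec κ) q () ())
        - tensor (fun q => Pgt n a u q () ()) (fun x => RG (Ggh n a) (Pgt n a) x (u + unitVec κ) () () - RG (Ggh n a) (Pgt n a) x u () ())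
        - tensor (fun q => Pgt n a u q () () - Pgt n a (u + unitVec κ) q () ()) (fun x => RG (Ggh n a) (Pgt n a) x u () ())) := by
  rw [dipPiece_apply]
  congr 1
  funext x q v w
  obtain ⟨⟩ := v; obtain ⟨⟩ := w
  simp only [Pi.sub_apply, Pi.add_apply, trK_apply, tensor]
  rw [cornerV_ghCur_apply κ u (Ggh n a) (Pgt n a) x q () (), cornerV_ghCur_apply κ u (Ggh n a) (Pgt n a) q x () ()]
  ring

/-- [folklore] **THE DIPOLE PIECE AS FOUR RANK-ONE BOND KERNELS**: `dipPiece = outer (∇δρ_u) (∇p_u) + outer (∇ρ_u) (∇δp_u) − outer (∇p_u) (∇δρ_u) − outer (∇δp_u) (∇ρ_u)`. -/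
theorem dipPiece_eq_outer :
    dipPiece n a κ u =
      outer (grad (fun x => RG (Ggh n a) (Pgt n a) x (u + unitVec κ) () () - RG (Ggh n a) (Pgt n a) x u () ())) (grad (fun q => Pgt n a u q () ()))
        + outer (grad (fun x => RG (Ggh n a) (Pgt n a) x u () ())) (grad (fun q => Pgt n a u q () () - Pgt n a (u + unitVec κ) q () ()))
        - outer (grad (fun q => Pgt n a u q () ())) (grad (fun x => RG (Ggh n a) (Pgt n a) x (u + unitVec κ) () () - RG (Ggh n a) (Pgt n a) x u () ()))
        - outer (grad (fun q => Pgt n a u q () () - Pgt n a (u + unitVec κ) q () ())) (grad (fun x => RG (Ggh n a) (Pgt n a) x u () ())) := by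
  rw [dipPiece_eq_dSw_tensor, dSw_sub, dSw_sub, dSw_add, dSw_tensor, dSw_tensor, dSw_tensor, dSw_tensor]

/-! ## §2 Localisation of the four factors -/

/-- [folklore] **SCALE-`n` SITE DAMPING ⟹ `LocV`**: `|f x| ≤ M·e^{−(δ∕n)‖x−u‖∞}` for all `x` (`δ > 0`) ⟹ `LocV (fun x _ => f x)` (centre `u`, rate `δ∕(4n)`,
`|·|₁ ≤ 4‖·‖∞`). -/
theorem locV_of_siteDamped {F : Type*} {f : Site 4 → ℝ} {M δ : ℝ} (hδ : 0 < δ) (hM : 0 ≤ M)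
    (h : ∀ x : Site 4, |f x| ≤ M * Real.exp (-(δ / n) * Beta.PoissonInterior.supNorm (x - u))) : LocV (fun (x : Site 4) (_ : F) => f x) := by
  have hn : (0 : ℝ) < n := by exact_mod_cast Nat.pos_of_ne_zero (NeZero.ne n)
  refine ⟨u, M, δ / (4 * n), by positivity, fun x _ => (h x).trans (mul_le_mul_of_nonneg_left (Real.exp_le_exp.2 ?_) hM)⟩
  have hl1 : l1 (x - u) ≤ 4 * (supNorm (x - u) : ℝ) := l1_le_four_mul_supNorm (x - u)
  rw [supNorm_eq] at hl1
  have : δ / (4 * n) * l1 (x - u) ≤ δ / n * (Beta.PoissonInterior.supNorm (x - u) : ℝ) := by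
    calc δ / (4 * n) * l1 (x - u) ≤ δ / (4 * n) * (4 * (Beta.PoissonInterior.supNorm (x - u) : ℝ)) := mul_le_mul_of_nonneg_left hl1 (by positivity)
      _ = δ / n * (Beta.PoissonInterior.supNorm (x - u) : ℝ) := by field_simp
  linarith

/-- [folklore] the `R`-column `ρ_u = RG(·,u)` is a localised bond function (leaf-05's profile `kV∕n²·e^{−(dR∕2n)‖x−u‖}∕nrm² ≤ kV∕n²·e^{…}`). -/
theorem locV_rho (ha : 0 < a) : LocV (fun (x : Site 4) (_ : Fin 4) => RG (Ggh n a) (Pgt n a) x u () ()) := by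
  have hn : (0 : ℝ) < n := by exact_mod_cast Nat.pos_of_ne_zero (NeZero.ne n)
  have hkV : 0 ≤ kV a / (n : ℝ) ^ 2 := div_nonneg (kV_nonneg_and ha).1 (by positivity)
  refine locV_of_siteDamped n u (F := Fin 4) (half_pos (dR_pos ha)) hkV fun x => (abs_RG_le_profile n ha x u).trans ?_
  rw [show dR a / 2 / (n : ℝ) = dR a / 2 / n from rfl]
  refine div_le_self (by positivity) ?_
  exact one_le_pow₀ (one_le_nrm (d := 4) _)

/-- [folklore] the source dipole `δρ_u = RG(·,u+e_κ) − RG(·,u)` is a localised bond function (leaf-05's `abs_RG_right_diff_le_profile`: `kD∕n²·e∕nrm³`). -/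
theorem locV_drho (ha : 0 < a) :
    LocV (fun (x : Site 4) (_ : Fin 4) => RG (Ggh n a) (Pgt n a) x (u + unitVec κ) () () - RG (Ggh n a) (Pgt n a) x u () ()) := by
  have hn : (0 : ℝ) < n := by exact_mod_cast Nat.pos_of_ne_zero (NeZero.ne n)
  have hkD : 0 ≤ kD a / (n : ℝ) ^ 2 := div_nonneg (kD_nonneg ha) (by positivity)
  refine locV_of_siteDamped n u (F := Fin 4) (half_pos (dR_pos ha)) hkD fun x => (abs_RG_right_diff_le_profile n ha x u κ).trans ?_
  refine div_le_self (by positivity) ?_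
  exact one_le_pow₀ (one_le_nrm (d := 4) _)

/-- [folklore] the projector row `p_u = Pgt(u,·)` is a localised bond function (`abs_Pgt_le_sup`: `cPPs∕n⁴·e^{−δ_PP·dist(blk u, blk q)}`, owner's `locV_of_blockDecay`). -/
theorem locV_p (ha : 0 < a) : LocV (fun (q : Site 4) (_ : Fin 4) => Pgt n a u q () ()) :=
  locV_of_blockDecay n u (F := Fin 4) (M := cPPs 4 a / (n : ℝ) ^ 4) (deltaPP_pos 4 ha) fun q => by
    rw [dist_comm]; exact abs_Pgt_le_sup n ha u q () ()

/-- [folklore] the projector dipole `δp_u = Pgt(u,·) − Pgt(u+e_κ,·)` is a localised bond function (`abs_Pgt_diff_le_sup`: `cPPs∕n⁵·e^{−δ_PP·dist}`). -/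
theorem locV_dp (ha : 0 < a) : LocV (fun (q : Site 4) (_ : Fin 4) => Pgt n a u q () () - Pgt n a (u + unitVec κ) q () ()) :=
  locV_of_blockDecay n u (F := Fin 4) (M := cPPs 4 a / (n : ℝ) ^ 5) (deltaPP_pos 4 ha) fun q => by
    rw [dist_comm, abs_sub_comm]; exact abs_Pgt_diff_le_sup n ha u q κ () ()

/-- [folklore] `dipPiece` is localised, read off its rank-one form (the tree's `GluonNeedleSplit.loc_dipPiece` by another route). -/
theorem loc_dipPiece' (ha : 0 < a) : Loc (dipPiece n a κ u) := by
  rw [dipPiece_eq_outer n a κ u]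
  have h1 := locV_grad_of_locV (locV_drho n a κ u ha)
  have h2 := locV_grad_of_locV (locV_rho n a u ha)
  have h3 := locV_grad_of_locV (locV_p n a u ha)
  have h4 := locV_grad_of_locV (locV_dp n a κ u ha)
  exact (((loc_outer h1 h3).add (loc_outer h2 h4)).sub (loc_outer h3 h1)).sub (loc_outer h4 h2)

/-! ## §3 The word shapes of the dipole cells -/

variable {n a κ u}

/-- [folklore] **`dip ⊗ dSw(f ⊗ g)`** (the building block of the KK, KP, KN cells), over one spread leg `A`, for localised site functions `f`, `g`; with
`𝒫(h) := ⟨∇h, A∇f⟩` and `𝒬(h) := ⟨A∇h, ∇g⟩`: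
`bubble A (dipPiece n a κ u) (dSw (tensor f g)) = 𝒫(p_u)·𝒬(δρ_u) + 𝒫(δp_u)·𝒬(ρ_u) − 𝒫(δρ_u)·𝒬(p_u) − 𝒫(ρ_u)·𝒬(δp_u)`. -/
theorem bubble_dip_dSw (ha : 0 < a) {A : MKer 4 (Fin 4)} (hA : Spr A) {f g : Site 4 → ℝ} (hf : LocV (fun x (_ : Fin 4) => f x))
    (hg : LocV (fun x (_ : Fin 4) => g x)) :
    bubble A (dipPiece n a κ u) (dSw (tensor f g)) =
      pairing (grad (fun q => Pgt n a u q () ())) (applyK A (grad f))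
          * pairing (applyK A (grad (fun x => RG (Ggh n a) (Pgt n a) x (u + unitVec κ) () () - RG (Ggh n a) (Pgt n a) x u () ()))) (grad g)
        + pairing (grad (fun q => Pgt n a u q () () - Pgt n a (u + unitVec κ) q () ())) (applyK A (grad f))
          * pairing (applyK A (grad (fun x => RG (Ggh n a) (Pgt n a) x u () ()))) (grad g)
        - pairing (grad (fun x => RG (Ggh n a) (Pgt n a) x (u + unitVec κ) () () - RG (Ggh n a) (Pgt n a) x u () ())) (applyK A (grad f))
          * pairing (applyK A (grad (fun q => Pgt n a u q () ()))) (grad g)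
        - pairing (grad (fun x => RG (Ggh n a) (Pgt n a) x u () ())) (applyK A (grad f))
          * pairing (applyK A (grad (fun q => Pgt n a u q () () - Pgt n a (u + unitVec κ) q () ()))) (grad g) := by
  have h1 := locV_drho n a κ u ha
  have h2 := locV_rho n a u ha
  have h3 := locV_p n a u ha
  have h4 := locV_dp n a κ u ha
  have hZ := loc_dSw_tensor hf hg
  have l13 := loc_dSw_tensor h1 h3
  have l24 := loc_dSw_tensor h2 h4
  have l31 := loc_dSw_tensor h3 h1
  have l42 := loc_dSw_tensor h4 h2
  rw [dipPiece_eq_dSw_tensor n a κ u, dSw_sub, dSw_sub, dSw_add,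
    bubble_sub_left hA ((l13.add l24).sub l31) l42 hZ, bubble_sub_left hA (l13.add l24) l31 hZ, bubble_add_left hA l13 l24 hZ,
    bubble_dSw_dSw, bubble_dSw_dSw, bubble_dSw_dSw, bubble_dSw_dSw]

/-- [folklore] **THE PARTNER DIPOLE EXPANDED**: over one spread leg `A` and a localised `Y`,
`bubble A Y (dipPiece n a κ′ u′) = bubble A Y (dSw (δρ′ ⊗ p′)) + bubble A Y (dSw (ρ′ ⊗ δp′)) − bubble A Y (dSw (p′ ⊗ δρ′)) − bubble A Y (dSw (δp′ ⊗ ρ′))`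
(primes = the four functions at the bond `(u′,κ′)`); with `bubble_dip_dSw` at `Y = dipPiece n a κ u` the sixteen terms of «KK». -/
theorem bubble_dip_expand_right (ha : 0 < a) {A : MKer 4 (Fin 4)} (hA : Spr A) {Y : MKer 4 (Fin 4)} (hY : Loc Y) (κ' : Fin 4) (u' : Site 4) :
    bubble A Y (dipPiece n a κ' u') =
      bubble A Y (dSw (tensor (fun x => RG (Ggh n a) (Pgt n a) x (u' + unitVec κ') () () - RG (Ggh n a) (Pgt n a) x u' () ()) (fun q => Pgt n a u' q () ())))
        + bubble A Y (dSw (tensor (fun x => RG (Ggh n a) (Pgt n a) x u' () ()) (fun q => Pgt n a u' q () () - Pgt n a (u' + unitVec κ') q () ())))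
        - bubble A Y (dSw (tensor (fun q => Pgt n a u' q () ()) (fun x => RG (Ggh n a) (Pgt n a) x (u' + unitVec κ') () () - RG (Ggh n a) (Pgt n a) x u' () ())))
        - bubble A Y (dSw (tensor (fun q => Pgt n a u' q () () - Pgt n a (u' + unitVec κ') q () ()) (fun x => RG (Ggh n a) (Pgt n a) x u' () ()))) := by
  have h1 := locV_drho n a κ' u' ha
  have h2 := locV_rho n a u' ha
  have h3 := locV_p n a u' ha
  have h4 := locV_dp n a κ' u' ha
  have l13 := loc_dSw_tensor h1 h3
  have l24 := loc_dSw_tensor h2 h4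
  have l31 := loc_dSw_tensor h3 h1
  have l42 := loc_dSw_tensor h4 h2
  rw [dipPiece_eq_dSw_tensor n a κ' u', dSw_sub, dSw_sub, dSw_add,
    bubble_sub_right hA hY ((l13.add l24).sub l31) l42, bubble_sub_right hA hY (l13.add l24) l31, bubble_add_right hA hY l13 l24]

end Summit.QuantumFields.BalabanUV.Beta.D1BFx.NeedleDipShape

end
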